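import Literature.Geometry.Kaehler.ComplexTorusPicardNumberProduct
import Literature.Geometry.Kaehler.ComplexTorusFiniteProduct
import Literature.Geometry.Kaehler.ComplexTorusEllipticCurveCMIsogenyClasses
import Mathlib.NumberTheory.Real.Irrational
import Mathlib.NumberTheory.PrimeCounting
import HarnessLib

/-!
# The Picard number of a finite product of complex tori: `ρ(∏ X_k) = Σ ρ(X_k) + Σ_{k<l} rk Hom(X_k, X_l)`,
# additivity for pairwise `Hom`-orthogonal factors (Hulek–Laface 2019, Cor. 2.3) and the extremal family
# `E^{g−r+1} × E_1 × ⋯ × E_{r−1}` of Picard number `[g − (r−1)]² + (r−1)` (Hulek–Laface 2019, Prop. 3.1)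

Layer `Literature/Geometry/Kaehler`, namespace `Literature.Geometry.Kaehler.ComplexTorus`; lane
`lit-hodgefound` (Track 2 foundations library), Layer A4 row A4-13. Sequel of
`ComplexTorusPicardNumberProduct.lean` (two factors: `ρ(X₁ × X₂) = ρ(X₁) + ρ(X₂) + dim_ℚ Hom_ℚ(X₁, X₂)`
for `X₂` an abelian variety, `IsAbelianVariety.finrank_neronSeveriGroup_prod'`; `finrank_homRat_prod_left`
of `ComplexTorusProductHomRank.lean`) and of `ComplexTorusFiniteProduct.lean` (the finite product torus
`∏_{k<n} X_k = ComplexTorus (piPeriod Φ)` of a family `Φ : Fin n → (ℝ^ι ≃ E)` of tori on one ambient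
space), by induction on the number of factors along `∏_{k<n+1} X_k ≅ (∏_{k<n} X_k) × X_n`
(`isIsomorphic_piPeriod_succ`, from `isIsomorphic_of_reindex` of `ComplexTorusProductPowerIsomorphisms.lean`).

Source followed, verbatim (K. Hulek, R. Laface, *On the Picard numbers of abelian varieties*, Ann. Sc.
Norm. Super. Pisa Cl. Sci. (5) XIX (2019); held text `paper:arxiv-1703.05882` p0005–p0007):
"**Corollary 2.3.** Let `A_1, …, A_r` be simple abelian varieties, such that `A_i` is not isogenous to
`A_j` for `i ≠ j`. Then, `ρ(∏_{i=1}^r A_i^{n_i}) = Σ_{i=1}^r ρ(A_i^{n_i})`." — "we prove in Proposition 2.2 a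
splitting result concerning the Picard group of varieties of the form `A × B` with `Hom(A,B) = 0`, which
allows us to compute the Picard number of such products. This, together with Murty's result, provides us
with a theoretical algorithm for computing the Picard number of a given abelian variety." —
"**Proposition 3.1.** For integers `r, g ∈ ℕ` such that `r ≤ g`, one has `M_{r,g} = [g − (r−1)]² + (r−1)`.
This value is attained as the Picard number of `E^{g−r+1} × E_1 × ⋯ × E_{r−1}`, where `E` is a CM elliptic
curve not isogenous to any of the `E_i`'s, and `E_i` and `E_j` are not isogenous for `i ≠ j`. *Proof.* If
`A ∼ A_1 × ⋯ × A_r`, `Hom(A_i, A_j) = 0` for `i ≠ j`, then `ρ(A) ≤ k_1² + ⋯ + k_r²` where `k_i := dim A_i`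
[…] By applying Proposition 2.2 and Corollary 2.6 one can see that the abelian variety
`E^{g−r+1} × E_1 × ⋯ × E_{r−1}` with `E` a CM curve and `E, E_i, E_j` for `i ≠ j` not pairwise mutually
isogeneous, has Picard number `[g − (r−1)]² + (r−1)`" — "**Remark 3.3.** The numbers `M_{r,g}` give the
following (strictly) increasing sequence of positive integers: `g = M_{g,g} < M_{g−1,g} < ⋯ < M_{1,g} = g²`."

## Contents (theorems only; no definition, no named fact, net debt 0)

* §1 **`isIsomorphic_piPeriod_succ`** (`∏_{k<n+1} X_k ≅ (∏_{k<n} X_k) × X_n`), `finrank_neronSeveriGroup_pi_zero`.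
* §2 **`finrank_homRat_pi_left`** (`dim_ℚ Hom_ℚ(∏ X_k, Y) = Σ_k dim_ℚ Hom_ℚ(X_k, Y)`),
  **`finrank_homRat_pi_right`**, `homRat_pi_left_eq_bot_iff`, `homRat_pi_right_eq_bot_iff`.
* §3 **`finrank_neronSeveriGroup_pi`**: for a family of abelian varieties
  `ρ(∏_{k<n} X_k) = Σ_k ρ(X_k) + Σ_{k<l} dim_ℚ Hom_ℚ(X_k, X_l)` (the "theoretical algorithm");
  **Hulek–Laface Cor. 2.3 for `n` factors** `finrank_neronSeveriGroup_pi_eq_sum_of_pairwise`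
  (pairwise `Hom = 0` ⟹ `ρ(∏ X_k) = Σ ρ(X_k)`), `finrank_neronSeveriGroup_sum_le_pi`;
  **Prop. 3.1 (proof)** `finrank_neronSeveriGroup_pi_le_of_pairwise` (`ρ ≤ Σ k_i² = n g²`) and its
  isogeny-invariant form `IsIsogenous.finrank_neronSeveriGroup_le_of_pairwise`.
* §4 products of elliptic curves: **`finrank_neronSeveriGroup_pi_ellipticPeriod`**
  (`ρ(E_{τ₀} × ⋯ × E_{τ_{n−1}}) = n + Σ_{k<l} rk Hom(E_{τ_k}, E_{τ_l})`),
  `finrank_neronSeveriGroup_pi_ellipticPeriod_of_pairwise_not_isIsogenous` (`= n`, `M_{g,g} = g`), and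
  **Prop. 3.1's extremal family** `finrank_neronSeveriGroup_pi_ellipticPeriod_eq_card_sq_add`:
  if `τ_k = τ₀` (imaginary quadratic) for `k ∈ S` and all other pairs of curves are non-isogenous, then
  `ρ = |S|² + (n − |S|)` — with `n = g`, `|S| = g − r + 1` this is `M_{r,g} = [g − (r−1)]² + (r−1)`.
* §5 (add-only sequel) realisation: `not_isIsogenous_ellipticPeriod_I_mul_sqrt` (`E_{i√m} ≁ E_{i√m'}` for
  `m m'` not a square, via the tree's `isIsogenous_ellipticPeriod_iff_mem_span_one_tau`) and
  **`exists_pi_ellipticPeriod_finrank_neronSeveriGroup_eq`**: for `1 ≤ r ≤ g` the product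
  `E_i^{g−r+1} × E_{i√p₁} × ⋯ × E_{i√p_{r−1}}` (`p_j` distinct primes) has `ρ = [g − (r−1)]² + (r−1)` —
  "this value is attained" (Prop. 3.1) / the chain `g = M_{g,g} < ⋯ < M_{1,g} = g²` (Remark 3.3) is realised.

Scope: families on ONE ambient space `E` (all factors of the same dimension — every product of elliptic
curves, and every `E^{m} × E_1 × ⋯ × E_{r−1}`); products of factors of different dimensions live on the
dependent product `sigmaPiPeriod` of `ComplexTorusPoincareCompleteReducibilityIsogeny.lean` and are not
treated here.

## References

* [HulekLaface2019PicardNumbersAV] K. Hulek, R. Laface, *On the Picard numbers of abelian varieties*,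
  Ann. Sc. Norm. Super. Pisa Cl. Sci. (5) XIX (2019) 1199–1224 (arXiv:1703.05882), §2.1 Prop. 2.2,
  Cor. 2.3, Cor. 2.6; §3.1 Prop. 3.1, Cor. 3.2, Rem. 3.3.
* [Lange2023AbelianVarietiesComplex] H. Lange, *Abelian Varieties over the Complex Numbers* (2023), §1.1.2
  (products of complex tori), §1.3.1 Exercise 1.3.4 (10) (the Picard number), §2.4.4 Cor. 2.4.26 (proof).
* [Silverman1994] J. H. Silverman, *Advanced Topics in the Arithmetic of Elliptic Curves* (GTM 151, 1994),
  Ch. II Exercise 2.3 (isogeny classes of CM curves; the tree's `isIsogenous_ellipticPeriod_iff_mem_span_one_tau`).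
-/

noncomputable section

set_option maxSynthPendingDepth 3

open Module Matrix Function
open Complex (I)

namespace Literature.Geometry.Kaehler

namespace ComplexTorus

/-! ## §1 `∏_{k<n+1} X_k ≅ (∏_{k<n} X_k) × X_n` -/

section Succ

variable {ι : Type*} [Fintype ι] [DecidableEq ι] {E : Type*} [NormedAddCommGroup E] [NormedSpace ℂ E]
  {n : ℕ}

variable (Φ : Fin (n + 1) → ((ι → ℝ) ≃L[ℝ] E))

/-- **`X₀ × ⋯ × X_n ≅ (X₀ × ⋯ × X_{n−1}) × X_n`**: splitting off the last factor of a finite product torus is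
an isomorphism of complex tori (relabel the lattice basis `Fin (n+1) × ι ≃ (Fin n ⊕ Fin 1) × ι ≃
(Fin n × ι) ⊕ ι`, identify `E^{n+1} = Eⁿ × E`). [cite: Lange2023AbelianVarietiesComplex, §1.1.2 (products of complex tori), p. 21] -/
theorem isIsomorphic_piPeriod_succ :
    IsIsomorphic (piPeriod Φ) (prodPeriod (piPeriod fun k : Fin n ↦ Φ k.castSucc) (Φ (Fin.last n))) := by
  refine isIsomorphic_of_reindex _ _
    (((Equiv.prodCongr finSumFinEquiv.symm (Equiv.refl ι)).trans (Equiv.sumProdDistrib (Fin n) (Fin 1) ι)).trans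
      (Equiv.sumCongr (Equiv.refl _) (Equiv.uniqueProd ι (Fin 1))))
    ((ContinuousLinearMap.pi fun k : Fin n ↦
        (ContinuousLinearMap.proj (R := ℂ) (φ := fun _ : Fin (n + 1) ↦ E) k.castSucc)).prod
      (ContinuousLinearMap.proj (R := ℂ) (φ := fun _ : Fin (n + 1) ↦ E) (Fin.last n)))
    fun x ↦ ?_
  have hlast : Fin.natAdd n (default : Fin 1) = Fin.last n := Fin.ext (by simp)
  rw [prodPeriod_apply, ContinuousLinearMap.prod_apply]
  refine Prod.ext (funext fun k ↦ ?_) ?_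
  · simp only [ContinuousLinearMap.pi_apply, ContinuousLinearMap.proj_apply, piPeriod_apply,
      Equiv.symm_trans_apply, Equiv.sumCongr_symm, Equiv.sumCongr_apply, Sum.map_inl,
      Equiv.refl_symm, Equiv.refl_apply, Equiv.sumProdDistrib_symm_apply_left, Equiv.prodCongr_symm,
      Equiv.symm_symm, Equiv.prodCongr_apply, Prod.map_apply, finSumFinEquiv_apply_left]
    rfl
  · simp only [ContinuousLinearMap.proj_apply, piPeriod_apply, Equiv.symm_trans_apply, Equiv.sumCongr_symm,
      Equiv.sumCongr_apply, Sum.map_inr, Equiv.refl_symm, Equiv.sumProdDistrib_symm_apply_right,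
      Equiv.prodCongr_symm, Equiv.symm_symm, Equiv.prodCongr_apply, Prod.map_apply, Equiv.refl_apply,
      finSumFinEquiv_apply_right, Equiv.uniqueProd_symm_apply, hlast]

end Succ

section Zero

variable {ι : Type*} [Fintype ι] [DecidableEq ι] {E : Type*} [NormedAddCommGroup E] [NormedSpace ℂ E]
  (Φ : Fin 0 → ((ι → ℝ) ≃L[ℝ] E))

/-- The empty product torus is a point: `dim_ℂ E⁰ = 0`. [folklore] -/
private theorem finrank_pi_zero : finrank ℂ (Fin 0 → E) = 0 := finrank_zero_of_subsingleton

omit [DecidableEq ι] in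
/-- `ρ` of the empty product is `0`. [cite: Lange2023AbelianVarietiesComplex, §1.3.1 Exercise 1.3.4 (10)(b)] -/
theorem finrank_neronSeveriGroup_pi_zero : finrank ℤ (neronSeveriGroup (piPeriod Φ)) = 0 := by
  have h := finrank_neronSeveriGroup_le_sq (piPeriod Φ)
  rw [finrank_pi_zero] at h
  simpa using h

/-- `Hom_ℚ` out of the empty product is `0`. [folklore] -/
private theorem finrank_homRat_pi_zero_left {ι' : Type*} [Fintype ι'] [DecidableEq ι'] {E' : Type*}
    [NormedAddCommGroup E'] [NormedSpace ℂ E'] (Ψ : (ι' → ℝ) ≃L[ℝ] E') :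
    finrank ℚ (homRat (piPeriod Φ) Ψ) = 0 := by
  haveI : Subsingleton (Matrix ι' (Fin 0 × ι) ℚ) := ⟨fun A B ↦ Matrix.ext fun _ j ↦ Fin.elim0 j.1⟩
  exact finrank_zero_of_subsingleton

/-- `Hom_ℚ` into the empty product is `0`. [folklore] -/
private theorem finrank_homRat_pi_zero_right {ι' : Type*} [Fintype ι'] [DecidableEq ι'] {E' : Type*}
    [NormedAddCommGroup E'] [NormedSpace ℂ E'] (Ψ : (ι' → ℝ) ≃L[ℝ] E') :
    finrank ℚ (homRat Ψ (piPeriod Φ)) = 0 := by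
  haveI : Subsingleton (Matrix (Fin 0 × ι) ι' ℚ) := ⟨fun A B ↦ Matrix.ext fun i _ ↦ Fin.elim0 i.1⟩
  exact finrank_zero_of_subsingleton

end Zero

/-! ## §2 `Hom_ℚ` of a finite product, factor by factor -/

section Hom

variable {ι ι' : Type*} [Fintype ι] [Fintype ι'] [DecidableEq ι] [DecidableEq ι'] {E E' : Type*}
  [NormedAddCommGroup E] [NormedSpace ℂ E] [NormedAddCommGroup E'] [NormedSpace ℂ E']
  (Ψ : (ι' → ℝ) ≃L[ℝ] E')

/-- **`dim_ℚ Hom_ℚ(∏_{k<n} X_k, Y) = Σ_k dim_ℚ Hom_ℚ(X_k, Y)`** (Cor. 2.4.26 (proof): homomorphisms out of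
a product are rows of homomorphisms out of the factors). [cite: Lange2023AbelianVarietiesComplex, §2.4.4 Cor. 2.4.26 (proof), p. 124] -/
theorem finrank_homRat_pi_left :
    ∀ {n : ℕ} (Φ : Fin n → ((ι → ℝ) ≃L[ℝ] E)),
      finrank ℚ (homRat (piPeriod Φ) Ψ) = ∑ k, finrank ℚ (homRat (Φ k) Ψ)
  | 0, Φ => by rw [finrank_homRat_pi_zero_left, Finset.univ_eq_empty, Finset.sum_empty]
  | n + 1, Φ => by
    rw [(isIsomorphic_piPeriod_succ Φ).isIsogenous.finrank_homRat_eq_left Ψ, finrank_homRat_prod_left,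
      finrank_homRat_pi_left (fun k : Fin n ↦ Φ k.castSucc), Fin.sum_univ_castSucc]

/-- **`dim_ℚ Hom_ℚ(Y, ∏_{k<n} X_k) = Σ_k dim_ℚ Hom_ℚ(Y, X_k)`.**
[cite: Lange2023AbelianVarietiesComplex, §2.4.4 Cor. 2.4.26 (proof), p. 124] -/
theorem finrank_homRat_pi_right :
    ∀ {n : ℕ} (Φ : Fin n → ((ι → ℝ) ≃L[ℝ] E)),
      finrank ℚ (homRat Ψ (piPeriod Φ)) = ∑ k, finrank ℚ (homRat Ψ (Φ k))
  | 0, Φ => by rw [finrank_homRat_pi_zero_right, Finset.univ_eq_empty, Finset.sum_empty]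
  | n + 1, Φ => by
    rw [(isIsomorphic_piPeriod_succ Φ).isIsogenous.finrank_homRat_eq_right Ψ, finrank_homRat_prod_right,
      finrank_homRat_pi_right (fun k : Fin n ↦ Φ k.castSucc), Fin.sum_univ_castSucc]

variable {n : ℕ} (Φ : Fin n → ((ι → ℝ) ≃L[ℝ] E))

/-- `Hom_ℚ(∏ X_k, Y) = 0` iff `Hom_ℚ(X_k, Y) = 0` for every `k`.
[cite: Lange2023AbelianVarietiesComplex, §2.4.4 Cor. 2.4.26 (proof), p. 124] -/
theorem homRat_pi_left_eq_bot_iff : homRat (piPeriod Φ) Ψ = ⊥ ↔ ∀ k, homRat (Φ k) Ψ = ⊥ := by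
  simp_rw [← Submodule.finrank_eq_zero, finrank_homRat_pi_left Ψ Φ, Finset.sum_eq_zero_iff, Finset.mem_univ,
    forall_const]

/-- `Hom_ℚ(Y, ∏ X_k) = 0` iff `Hom_ℚ(Y, X_k) = 0` for every `k`.
[cite: Lange2023AbelianVarietiesComplex, §2.4.4 Cor. 2.4.26 (proof), p. 124] -/
theorem homRat_pi_right_eq_bot_iff : homRat Ψ (piPeriod Φ) = ⊥ ↔ ∀ k, homRat Ψ (Φ k) = ⊥ := by
  simp_rw [← Submodule.finrank_eq_zero, finrank_homRat_pi_right Ψ Φ, Finset.sum_eq_zero_iff, Finset.mem_univ,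
    forall_const]

end Hom

/-! ## §3 The Picard number of a finite product of abelian varieties -/

section Pi

variable {ι : Type*} [Fintype ι] [DecidableEq ι] {E : Type*} [NormedAddCommGroup E] [NormedSpace ℂ E]

/-- The cross sum splits off its last column: `Σ_{k<l≤n} h(k,l) = Σ_{k<l<n} h(k,l) + Σ_{k<n} h(k,n)`. [folklore] -/
private theorem sum_sum_ite_lt_succ {n : ℕ} (h : Fin (n + 1) → Fin (n + 1) → ℕ) :
    (∑ l : Fin (n + 1), ∑ k : Fin (n + 1), if k < l then h k l else 0) =
      (∑ l : Fin n, ∑ k : Fin n, if k < l then h k.castSucc l.castSucc else 0) +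
        ∑ k : Fin n, h k.castSucc (Fin.last n) := by
  rw [Fin.sum_univ_castSucc]
  congr 1
  · refine Finset.sum_congr rfl fun l _ ↦ ?_
    rw [Fin.sum_univ_castSucc, if_neg (lt_asymm (Fin.castSucc_lt_last l)), Nat.add_zero]
    refine Finset.sum_congr rfl fun k _ ↦ ?_
    simp only [Fin.castSucc_lt_castSucc_iff]
  · rw [Fin.sum_univ_castSucc, if_neg (lt_irrefl _), Nat.add_zero]
    refine Finset.sum_congr rfl fun k _ ↦ ?_
    rw [if_pos (Fin.castSucc_lt_last k)]

/-- **The Picard number of a finite product of abelian varieties** ("a theoretical algorithm for computing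
the Picard number"): for abelian varieties `X₀, …, X_{n−1}` (complex tori with a polarisation, on one
ambient space),
`ρ(X₀ × ⋯ × X_{n−1}) = Σ_k ρ(X_k) + Σ_{k<l} dim_ℚ Hom_ℚ(X_k, X_l)` — Hulek–Laface's Prop. 2.2 / Cor. 2.3
iterated along `∏_{k≤n} X_k ≅ (∏_{k<n} X_k) × X_n`. [cite: HulekLaface2019PicardNumbersAV, §2.1 Prop. 2.2 and Cor. 2.3; §1 ("theoretical algorithm")] -/
theorem finrank_neronSeveriGroup_pi :
    ∀ {n : ℕ} (Φ : Fin n → ((ι → ℝ) ≃L[ℝ] E)) (_ : ∀ k, IsAbelianVariety (Φ k)),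
      finrank ℤ (neronSeveriGroup (piPeriod Φ)) =
        (∑ k, finrank ℤ (neronSeveriGroup (Φ k))) +
          ∑ l, ∑ k, if k < l then finrank ℚ (homRat (Φ k) (Φ l)) else 0
  | 0, Φ, _ => by
    rw [finrank_neronSeveriGroup_pi_zero, Finset.univ_eq_empty, Finset.sum_empty, Finset.sum_empty, Nat.add_zero]
  | n + 1, Φ, hA => by
    rw [(isIsomorphic_piPeriod_succ Φ).isIsogenous.finrank_neronSeveriGroup_eq _ _,
      (hA (Fin.last n)).finrank_neronSeveriGroup_prod' (piPeriod fun k : Fin n ↦ Φ k.castSucc),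
      finrank_neronSeveriGroup_pi (fun k : Fin n ↦ Φ k.castSucc) (fun k ↦ hA k.castSucc),
      finrank_homRat_pi_left, sum_sum_ite_lt_succ (fun k l ↦ finrank ℚ (homRat (Φ k) (Φ l))),
      Fin.sum_univ_castSucc (fun k ↦ finrank ℤ (neronSeveriGroup (Φ k)))]
    ring

variable {n : ℕ} (Φ : Fin n → ((ι → ℝ) ≃L[ℝ] E))

/-- `Σ_k ρ(X_k) ≤ ρ(∏ X_k)` for abelian varieties (`⊕ pr_k^* NS(X_k) ⊆ NS(∏ X_k)`).
[cite: HulekLaface2019PicardNumbersAV, §2.1 (before Prop. 2.2)] -/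
theorem finrank_neronSeveriGroup_sum_le_pi (hA : ∀ k, IsAbelianVariety (Φ k)) :
    ∑ k, finrank ℤ (neronSeveriGroup (Φ k)) ≤ finrank ℤ (neronSeveriGroup (piPeriod Φ)) := by
  rw [finrank_neronSeveriGroup_pi Φ hA]
  exact Nat.le_add_right _ _

/-- **Hulek–Laface 2019, Cor. 2.3 (additivity for `n` pairwise `Hom`-orthogonal factors): if
`Hom(X_k, X_l) = 0` for all `k < l` then `ρ(X₀ × ⋯ × X_{n−1}) = Σ_k ρ(X_k)`** ("Let `A_1, …, A_r` be simple
abelian varieties, such that `A_i` is not isogenous to `A_j` for `i ≠ j`. Then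
`ρ(∏ A_i^{n_i}) = Σ ρ(A_i^{n_i})`" — non-isogenous simple factors, or their powers, have `Hom = 0`).
[cite: HulekLaface2019PicardNumbersAV, §2.1 Cor. 2.3] -/
theorem finrank_neronSeveriGroup_pi_eq_sum_of_pairwise (hA : ∀ k, IsAbelianVariety (Φ k))
    (h : ∀ k l, k < l → homRat (Φ k) (Φ l) = ⊥) :
    finrank ℤ (neronSeveriGroup (piPeriod Φ)) = ∑ k, finrank ℤ (neronSeveriGroup (Φ k)) := by
  rw [finrank_neronSeveriGroup_pi Φ hA, Nat.add_eq_left]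
  refine Finset.sum_eq_zero fun l _ ↦ Finset.sum_eq_zero fun k _ ↦ ?_
  split_ifs with hkl
  · rw [h k l hkl, finrank_bot]
  · rfl

/-- **Hulek–Laface 2019, Prop. 3.1 (proof): "If `A ∼ A_1 × ⋯ × A_r`, `Hom(A_i, A_j) = 0` for `i ≠ j`, then
`ρ(A) ≤ k_1² + ⋯ + k_r²`"** — here for the product itself, factors of common dimension `g = dim_ℂ E`:
`ρ(∏ X_k) ≤ n · g²`. [cite: HulekLaface2019PicardNumbersAV, §3.1 Prop. 3.1 (proof)] -/
theorem finrank_neronSeveriGroup_pi_le_of_pairwise (hA : ∀ k, IsAbelianVariety (Φ k))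
    (h : ∀ k l, k < l → homRat (Φ k) (Φ l) = ⊥) :
    finrank ℤ (neronSeveriGroup (piPeriod Φ)) ≤ n * finrank ℂ E ^ 2 := by
  rw [finrank_neronSeveriGroup_pi_eq_sum_of_pairwise Φ hA h]
  calc ∑ k, finrank ℤ (neronSeveriGroup (Φ k)) ≤ ∑ _k : Fin n, finrank ℂ E ^ 2 :=
        Finset.sum_le_sum fun k _ ↦ finrank_neronSeveriGroup_le_sq (Φ k)
    _ = n * finrank ℂ E ^ 2 := by rw [Finset.sum_const, Finset.card_univ, Fintype.card_fin, smul_eq_mul]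

/-- **Prop. 3.1 (proof), as printed: `A ∼ X₀ × ⋯ × X_{n−1}` with pairwise `Hom(X_k, X_l) = 0` ⟹
`ρ(A) ≤ Σ k_i² = n g²`** (`ρ` is an isogeny invariant). [cite: HulekLaface2019PicardNumbersAV, §3.1 Prop. 3.1 (proof)] -/
theorem IsIsogenous.finrank_neronSeveriGroup_le_of_pairwise {ι' : Type*} [Fintype ι'] [DecidableEq ι']
    {E' : Type*} [NormedAddCommGroup E'] [NormedSpace ℂ E'] {Ψ : (ι' → ℝ) ≃L[ℝ] E'}
    (hΨ : IsIsogenous Ψ (piPeriod Φ)) (hA : ∀ k, IsAbelianVariety (Φ k))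
    (h : ∀ k l, k < l → homRat (Φ k) (Φ l) = ⊥) :
    finrank ℤ (neronSeveriGroup Ψ) ≤ n * finrank ℂ E ^ 2 := by
  rw [hΨ.finrank_neronSeveriGroup_eq Ψ (piPeriod Φ)]
  exact finrank_neronSeveriGroup_pi_le_of_pairwise Φ hA h

end Pi

/-! ## §4 Products of elliptic curves and the extremal family of Prop. 3.1 -/

section Elliptic

variable {n : ℕ} {τ : Fin n → ℂ} (hτ : ∀ k, 0 < (τ k).im)

/-- **The Picard number of a product of elliptic curves:
`ρ(E_{τ₀} × ⋯ × E_{τ_{n−1}}) = n + Σ_{k<l} rk Hom(E_{τ_k}, E_{τ_l})`** (`ρ(E) = 1`; Cor. 2.3's mechanism with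
the cross terms kept). [cite: HulekLaface2019PicardNumbersAV, §2.1 Cor. 2.3 and §3.1 Prop. 3.1 (proof: "By applying Proposition 2.2 and Corollary 2.6 …")] -/
theorem finrank_neronSeveriGroup_pi_ellipticPeriod :
    finrank ℤ (neronSeveriGroup (piPeriod fun k ↦ ellipticPeriod (hτ k).ne')) =
      n + ∑ l, ∑ k, if k < l then
        finrank ℚ (homRat (ellipticPeriod (hτ k).ne') (ellipticPeriod (hτ l).ne')) else 0 := by
  rw [finrank_neronSeveriGroup_pi _ fun k ↦ isAbelianVariety_elliptic (hτ k)]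
  congr 1
  rw [Finset.sum_congr rfl fun k _ ↦ finrank_neronSeveriGroup_eq_one_of_finrank_eq_one _ (Module.finrank_self ℂ),
    Finset.sum_const, Finset.card_univ, Fintype.card_fin, smul_eq_mul, mul_one]

/-- **`ρ(E_{τ₀} × ⋯ × E_{τ_{n−1}}) = n` for pairwise non-isogenous elliptic curves** (`M_{g,g} = g`, Remark
3.3: the smallest of the maxima). [cite: HulekLaface2019PicardNumbersAV, §3.1 Prop. 3.1 and Remark 3.3] -/
theorem finrank_neronSeveriGroup_pi_ellipticPeriod_of_pairwise_not_isIsogenous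
    (hni : ∀ k l, k < l → ¬ IsIsogenous (ellipticPeriod (hτ k).ne') (ellipticPeriod (hτ l).ne')) :
    finrank ℤ (neronSeveriGroup (piPeriod fun k ↦ ellipticPeriod (hτ k).ne')) = n := by
  rw [finrank_neronSeveriGroup_pi_eq_sum_of_pairwise _ (fun k ↦ isAbelianVariety_elliptic (hτ k))
    fun k l hkl ↦ (isSimple_of_card_eq_two _ (Fintype.card_fin 2)).homRat_eq_bot
      (isSimple_of_card_eq_two _ (Fintype.card_fin 2)) (hni k l hkl),
    Finset.sum_congr rfl fun k _ ↦ finrank_neronSeveriGroup_eq_one_of_finrank_eq_one _ (Module.finrank_self ℂ),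
    Finset.sum_const, Finset.card_univ, Fintype.card_fin, smul_eq_mul, mul_one]

/-- Counting the pairs `k < l` of a finite set twice gives its off-diagonal pairs:
`2 · #{(k,l) ∈ S² : k < l} = |S|² − |S|`. [folklore] -/
private theorem two_mul_sum_sum_ite_lt_mem (S : Finset (Fin n)) :
    2 * (∑ l : Fin n, ∑ k : Fin n, if k < l then (if k ∈ S ∧ l ∈ S then 1 else 0) else 0) =
      S.card * S.card - S.card := by
  set P := (S ×ˢ S).filter fun p : Fin n × Fin n ↦ p.1 < p.2 with hP
  set P' := (S ×ˢ S).filter fun p : Fin n × Fin n ↦ p.2 < p.1 with hP'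
  -- the double sum counts `P`
  have hcount : (∑ l : Fin n, ∑ k : Fin n, if k < l then (if k ∈ S ∧ l ∈ S then 1 else 0) else 0) = P.card := by
    have h1 : ∀ l : Fin n, (∑ k : Fin n, if k < l then (if k ∈ S ∧ l ∈ S then 1 else 0) else 0) =
        ∑ k ∈ S, if k < l then (if l ∈ S then 1 else 0) else 0 := fun l ↦ by
      rw [← Finset.sum_subset (Finset.subset_univ S)]
      · exact Finset.sum_congr rfl fun k hk ↦ by simp [hk]
      · intro k _ hk
        simp [hk]
    have h2 : (∑ l : Fin n, ∑ k ∈ S, if k < l then (if l ∈ S then 1 else 0) else 0) =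
        ∑ l ∈ S, ∑ k ∈ S, if k < l then 1 else 0 := by
      rw [← Finset.sum_subset (Finset.subset_univ S)]
      · exact Finset.sum_congr rfl fun l hl ↦ Finset.sum_congr rfl fun k _ ↦ by simp [hl]
      · intro l _ hl
        exact Finset.sum_eq_zero fun k _ ↦ by simp [hl]
    rw [Finset.sum_congr rfl fun l _ ↦ h1 l, h2, hP, Finset.card_filter, Finset.sum_product_right]
  -- swapping is a bijection `P ≃ P'`, and `P ⊔ P' = S.offDiag`
  have hswap : P.card = P'.card := by
    refine Finset.card_bij (fun p _ ↦ p.swap) (fun p hp ↦ ?_) (fun p _ q _ h ↦ Prod.swap_injective h)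
      (fun q hq ↦ ?_)
    · rw [hP, Finset.mem_filter, Finset.mem_product] at hp
      rw [hP', Finset.mem_filter, Finset.mem_product]
      exact ⟨⟨hp.1.2, hp.1.1⟩, hp.2⟩
    · rw [hP', Finset.mem_filter, Finset.mem_product] at hq
      refine ⟨q.swap, ?_, Prod.swap_swap q⟩
      rw [hP, Finset.mem_filter, Finset.mem_product]
      exact ⟨⟨hq.1.2, hq.1.1⟩, hq.2⟩
  have hunion : P ∪ P' = S.offDiag := by
    ext p
    simp only [hP, hP', Finset.mem_union, Finset.mem_filter, Finset.mem_product, Finset.mem_offDiag]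
    constructor
    · rintro (⟨⟨h1, h2⟩, h⟩ | ⟨⟨h1, h2⟩, h⟩)
      · exact ⟨h1, h2, h.ne⟩
      · exact ⟨h1, h2, h.ne'⟩
    · rintro ⟨h1, h2, hne⟩
      rcases lt_or_gt_of_ne hne with h | h
      · exact Or.inl ⟨⟨h1, h2⟩, h⟩
      · exact Or.inr ⟨⟨h1, h2⟩, h⟩
  have hdisj : Disjoint P P' := by
    rw [hP, hP']
    exact Finset.disjoint_filter.2 fun p _ h ↦ lt_asymm h
  rw [hcount, two_mul]
  calc P.card + P.card = P.card + P'.card := by rw [← hswap]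
    _ = (P ∪ P').card := (Finset.card_union_of_disjoint hdisj).symm
    _ = S.offDiag.card := by rw [hunion]
    _ = S.card * S.card - S.card := Finset.offDiag_card S

/-- Two presentations of the same curve: `Hom_ℚ(E_σ, E_{σ'}) = End_ℚ(E_σ)` for `σ = σ'`. [folklore] -/
private theorem finrank_homRat_ellipticPeriod_of_eq {σ σ' : ℂ} (hσ : σ.im ≠ 0) (hσ' : σ'.im ≠ 0) (h : σ = σ') :
    finrank ℚ (homRat (ellipticPeriod hσ) (ellipticPeriod hσ')) = finrank ℚ (endAlgRat (ellipticPeriod hσ)) := by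
  subst h
  exact finrank_homRat_self _

/-- **Hulek–Laface 2019, Prop. 3.1 — the extremal family, as printed: "`M_{r,g} = [g − (r−1)]² + (r−1)`.
This value is attained as the Picard number of `E^{g−r+1} × E_1 × ⋯ × E_{r−1}`, where `E` is a CM elliptic
curve not isogenous to any of the `E_i`'s, and `E_i` and `E_j` are not isogenous for `i ≠ j`."** Read on a
product of `n = g` elliptic curves `E_{τ₀} × ⋯ × E_{τ_{n−1}}` in which the curves indexed by `S` (of size
`g − r + 1`) are the CM curve `E_{τ₀}` (`τ₀` imaginary quadratic) and every other pair of curves is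
non-isogenous: `ρ = |S|² + (n − |S|)`. [cite: HulekLaface2019PicardNumbersAV, §3.1 Prop. 3.1] -/
theorem finrank_neronSeveriGroup_pi_ellipticPeriod_eq_card_sq_add (S : Finset (Fin n)) {τ₀ : ℂ} {a b : ℚ}
    (hq : τ₀ ^ 2 + a * τ₀ + b = 0) (hS : ∀ k ∈ S, τ k = τ₀)
    (hni : ∀ k l, k < l → ¬ (k ∈ S ∧ l ∈ S) →
      ¬ IsIsogenous (ellipticPeriod (hτ k).ne') (ellipticPeriod (hτ l).ne')) :
    finrank ℤ (neronSeveriGroup (piPeriod fun k ↦ ellipticPeriod (hτ k).ne')) = S.card ^ 2 + (n - S.card) := by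
  rw [finrank_neronSeveriGroup_pi_ellipticPeriod hτ]
  have hcross : ∀ k l : Fin n, k < l →
      finrank ℚ (homRat (ellipticPeriod (hτ k).ne') (ellipticPeriod (hτ l).ne')) =
        2 * (if k ∈ S ∧ l ∈ S then 1 else 0) := by
    intro k l hkl
    split_ifs with hmem
    · obtain ⟨hk, hl⟩ := hmem
      have hq' : τ k ^ 2 + a * τ k + b = 0 := by rw [hS k hk]; exact hq
      rw [finrank_homRat_ellipticPeriod_of_eq (hτ k).ne' (hτ l).ne' ((hS k hk).trans (hS l hl).symm),
        finrank_endAlgRat_ellipticPeriod_of_quadratic (hτ k).ne' hq', mul_one]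
    · rw [(isSimple_of_card_eq_two _ (Fintype.card_fin 2)).homRat_eq_bot
        (isSimple_of_card_eq_two _ (Fintype.card_fin 2)) (hni k l hkl hmem), finrank_bot, mul_zero]
  have hsum : (∑ l : Fin n, ∑ k : Fin n, if k < l then
      finrank ℚ (homRat (ellipticPeriod (hτ k).ne') (ellipticPeriod (hτ l).ne')) else 0) =
      2 * ∑ l : Fin n, ∑ k : Fin n, if k < l then (if k ∈ S ∧ l ∈ S then 1 else 0) else 0 := by
    rw [Finset.mul_sum]
    refine Finset.sum_congr rfl fun l _ ↦ ?_
    rw [Finset.mul_sum]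
    refine Finset.sum_congr rfl fun k _ ↦ ?_
    by_cases hkl : k < l
    · rw [if_pos hkl, if_pos hkl, hcross k l hkl]
    · rw [if_neg hkl, if_neg hkl, mul_zero]
  have hc : S.card ≤ n := (Finset.card_le_univ S).trans_eq (Fintype.card_fin n)
  have hcc : S.card ≤ S.card * S.card := Nat.le_mul_self _
  rw [hsum, two_mul_sum_sum_ite_lt_mem S, sq]
  omega

/-- **The case `S = everything`: `ρ(E_{τ₀}ⁿ) = n²` for a CM curve, recovered** (every pair contributes
`rk End(E_{τ₀}) = 2`; the tree's `finrank_neronSeveriGroup_pi_ellipticPeriod_eq_sq` is the general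
isogenous-CM statement). [cite: HulekLaface2019PicardNumbersAV, §2.2 Cor. 2.6] -/
theorem finrank_neronSeveriGroup_pi_ellipticPeriod_of_forall_eq {τ₀ : ℂ} {a b : ℚ}
    (hq : τ₀ ^ 2 + a * τ₀ + b = 0) (hS : ∀ k, τ k = τ₀) :
    finrank ℤ (neronSeveriGroup (piPeriod fun k ↦ ellipticPeriod (hτ k).ne')) = n ^ 2 := by
  have h := finrank_neronSeveriGroup_pi_ellipticPeriod_eq_card_sq_add hτ Finset.univ hq (fun k _ ↦ hS k)
    (fun k l _ hkl ↦ absurd ⟨Finset.mem_univ k, Finset.mem_univ l⟩ hkl)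
  rwa [Finset.card_univ, Fintype.card_fin, Nat.sub_self, Nat.add_zero] at h

end Elliptic


/-! ## §5 Realising `M_{r,g}`: the configuration `E_i^{g−r+1} × E_{i√p₁} × ⋯ × E_{i√p_{r−1}}` exists -/

section Realisation

/-- `E_{i√m} ≁ E_{i√m'}` when `m m'` is not a square: an isogeny would put `i√m'` in
`ℚ + ℚ·i√m` (Silverman AT II Ex. 2.3 at torus level, the tree's `isIsogenous_ellipticPeriod_iff_mem_span_one_tau`),
i.e. `√(m m') ∈ ℚ`. [cite: HulekLaface2019PicardNumbersAV, §3.1 Prop. 3.1 (proof: "`E, E_i, E_j` … not pairwise mutually isogeneous")] -/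
theorem not_isIsogenous_ellipticPeriod_I_mul_sqrt {m m' : ℕ} (hsq : ¬ IsSquare (m * m')) (h₁ : (I * (Real.sqrt m : ℂ)).im ≠ 0) (h₂ : (I * (Real.sqrt m' : ℂ)).im ≠ 0) :
    ¬ IsIsogenous (ellipticPeriod (τ := I * Real.sqrt m) h₁) (ellipticPeriod (τ := I * Real.sqrt m') h₂) := by
  intro h
  have hq : (I * (Real.sqrt m : ℂ)) ^ 2 + ((0 : ℚ) : ℂ) * (I * (Real.sqrt m : ℂ)) + ((m : ℚ) : ℂ) = 0 := by
    have hs : ((Real.sqrt m : ℝ) : ℂ) ^ 2 = (m : ℂ) := by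
      rw [← Complex.ofReal_pow, Real.sq_sqrt (Nat.cast_nonneg m), Complex.ofReal_natCast]
    rw [mul_pow, Complex.I_sq, hs]
    push_cast
    ring
  obtain ⟨a, b, hab⟩ := (mem_span_one_tau_iff (I * (Real.sqrt m : ℂ))).1
    ((isIsogenous_ellipticPeriod_iff_mem_span_one_tau h₁ h₂ hq).1 h)
  -- imaginary parts: `√m' = b √m`
  have him := congrArg Complex.im hab
  simp only [Complex.mul_im, Complex.I_re, Complex.I_im, Complex.ofReal_re, Complex.ofReal_im, zero_mul,
    one_mul, add_zero, Complex.add_im, Complex.ratCast_im, Complex.ratCast_re, mul_zero, zero_add,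
    Complex.mul_re, sub_zero] at him
  -- hence `√(m m') = b m` is rational
  have hrat : Real.sqrt ((m * m' : ℕ) : ℝ) = ((b * m : ℚ) : ℝ) := by
    rw [Nat.cast_mul, Real.sqrt_mul (Nat.cast_nonneg m), him, Rat.cast_mul, Rat.cast_natCast, mul_left_comm,
      Real.mul_self_sqrt (Nat.cast_nonneg m)]
  exact (irrational_sqrt_natCast_iff.2 hsq) ⟨b * m, hrat.symm⟩

/-- A prime is not a square. [folklore] -/
private theorem not_isSquare_one_mul_prime {p : ℕ} (hp : p.Prime) : ¬ IsSquare (1 * p) := by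
  rw [one_mul]
  exact irrational_sqrt_natCast_iff.1 hp.irrational_sqrt

/-- The product of two distinct primes is not a square. [folklore] -/
private theorem not_isSquare_prime_mul_prime {p q : ℕ} (hp : p.Prime) (hq : q.Prime) (hne : p ≠ q) :
    ¬ IsSquare (p * q) := by
  rintro ⟨k, hk⟩
  have hpk : p ∣ k := by
    have : p ∣ k * k := ⟨q, hk.symm⟩
    exact (hp.dvd_mul.1 this).elim id id
  obtain ⟨t, rfl⟩ := hpk
  have hqt : q = p * (t * t) := by
    have h' : p * q = p * (p * (t * t)) := by rw [hk]; ring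
    exact Nat.eq_of_mul_eq_mul_left hp.pos h'
  have hpq : p ∣ q := ⟨t * t, hqt⟩
  exact hne ((Nat.prime_dvd_prime_iff_eq hp hq).1 hpq)

/-- **Hulek–Laface 2019, Prop. 3.1 — `M_{r,g}` is attained, existence form: for `1 ≤ r ≤ g` there is a
product of `g` elliptic curves with Picard number `[g − (r−1)]² + (r−1)`**, namely
`E_i^{g−r+1} × E_{i√p₁} × ⋯ × E_{i√p_{r−1}}` for distinct primes `p_j` (`E_i` has complex multiplication;
`E_i`, `E_{i√p}`, `E_{i√p'}` are pairwise non-isogenous). [cite: HulekLaface2019PicardNumbersAV, §3.1 Prop. 3.1 and Remark 3.3] -/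
theorem exists_pi_ellipticPeriod_finrank_neronSeveriGroup_eq {g r : ℕ} (hr : 1 ≤ r) (hrg : r ≤ g) :
    ∃ (τ : Fin g → ℂ) (hτ : ∀ k, 0 < (τ k).im),
      finrank ℤ (neronSeveriGroup (piPeriod fun k ↦ ellipticPeriod (hτ k).ne')) =
        (g - (r - 1)) ^ 2 + (r - 1) := by
  classical
  set m := g - (r - 1) with hm
  -- the curves: `E_i` on the first `m` indices, `E_{i√p_k}` (`p_k` the `k`-th prime) on the others
  let σ : Fin g → ℝ := fun k ↦ if (k : ℕ) < m then 1 else Real.sqrt (Nat.nth Nat.Prime k)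
  have hσpos : ∀ k, 0 < σ k := fun k ↦ by
    by_cases hk : (k : ℕ) < m
    · simp [σ, hk]
    · simp only [σ, hk, if_false]
      exact Real.sqrt_pos.2 (by exact_mod_cast (Nat.prime_nth_prime k).pos)
  refine ⟨fun k ↦ I * (σ k : ℂ), fun k ↦ by simpa using hσpos k, ?_⟩
  set S : Finset (Fin g) := Finset.univ.filter fun k : Fin g ↦ (k : ℕ) < m with hS
  have hScard : S.card = m := by
    rw [hS, Fin.card_filter_val_lt, min_eq_right (by omega)]
  have hI : ∀ k ∈ S, I * (σ k : ℂ) = I := fun k hk ↦ by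
    rw [hS, Finset.mem_filter] at hk
    simp [σ, hk.2]
  have hq : I ^ 2 + ((0 : ℚ) : ℂ) * I + ((1 : ℚ) : ℂ) = 0 := by push_cast; rw [Complex.I_sq]; ring
  rw [finrank_neronSeveriGroup_pi_ellipticPeriod_eq_card_sq_add (fun k ↦ by simpa using hσpos k) S hq hI ?_,
    hScard]
  · omega
  -- the remaining pairs are non-isogenous
  intro k l hkl hmem
  have hσ1 : ∀ j : Fin g, (j : ℕ) < m → σ j = Real.sqrt (1 : ℕ) := fun j hj ↦ by simp [σ, hj]
  have hσp : ∀ j : Fin g, ¬ (j : ℕ) < m → σ j = Real.sqrt (Nat.nth Nat.Prime j) := fun j hj ↦ by simp [σ, hj]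
  by_cases hk : (k : ℕ) < m
  · have hl : ¬ (l : ℕ) < m := fun hl ↦ hmem ⟨by rw [hS, Finset.mem_filter]; exact ⟨Finset.mem_univ _, hk⟩,
      by rw [hS, Finset.mem_filter]; exact ⟨Finset.mem_univ _, hl⟩⟩
    have := not_isIsogenous_ellipticPeriod_I_mul_sqrt (m := 1) (m' := Nat.nth Nat.Prime l)
      (not_isSquare_one_mul_prime (Nat.prime_nth_prime l))
      (by simp) (by simpa [hσp l hl] using (hσpos l).ne')
    simpa only [hσ1 k hk, hσp l hl] using this
  · have hl : ¬ (l : ℕ) < m := fun hl ↦ hk (lt_trans (Fin.lt_def.1 hkl) hl)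
    have hne : Nat.nth Nat.Prime k ≠ Nat.nth Nat.Prime l := fun h ↦
      (Fin.ne_of_lt hkl) (Fin.ext (Nat.nth_injective Nat.infinite_setOf_prime h))
    have := not_isIsogenous_ellipticPeriod_I_mul_sqrt
      (not_isSquare_prime_mul_prime (Nat.prime_nth_prime k) (Nat.prime_nth_prime l) hne)
      (by simpa [hσp k hk] using (hσpos k).ne') (by simpa [hσp l hl] using (hσpos l).ne')
    simpa only [hσp k hk, hσp l hl] using this

end Realisation

end ComplexTorus

end Literature.Geometry.Kaehler

end
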